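import Summits.QuantumFields.YangMills.Theorems.VirialFluxGapResolventFieldPointwise
import HarnessLib

/-!
# Route `VirialFluxGap` (YangMills): FLAT CURVE DIRECTIONS are EXACT KERNEL VECTORS of the frame Hessian

Assignment (K) of the ⟨stmt-QuantumFields-24141⟩ `PeriodicSoftness` team, generic half (LEAD ruling 2026-08-30T23:30Z: the Euler field is
hosted on the tree-gauged space `X_fix`; the generic chart needs `m = 4` exact kernel vectors of the frame Hessian at the Taylor base point, fed
to ✓`ResolventField.trace_resolvent_le` through ✓`FrameHessian.approxKernel_of_kernel`).  In fcl-p3's frame letters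
(✓`VirialFluxGapRingFrameHessian` ∕ ✓`VirialFluxGapRingFrameTaylor` ∕ ✓`VirialFluxGapResolventFieldPointwise`: `multiCurve`, `frameD`, `dirOf`,
`frameHessRaw`, `frameHess`), AGNOSTIC of the frame family `τ`:

* ★ `frameD_frameD_ringPoly_eq_zero_of_flat` — if `F₀ ≡ 0` along the multi-direction curve `s ↦ p·exp(sY)` then `∂_Y∂_Y F₀(p) = 0`
  (uniqueness of derivatives along the constant function, twice, with ✓`hasDerivAt_ringDeficit_multiCurve` ∕ ✓`hasDerivAt_comp_multiCurve`);
* ★ `mulVec_eq_zero_of_nonneg_of_isotropic` — a symmetric real matrix with non-negative quadratic form kills its isotropic vectors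
  (`(k+tw)ᵀB(k+tw) ≥ 0` for all `t`);
* `frameHessRaw_transpose_of_zero`, `frameHessRaw_nonneg_of_zero`, `frameHess_eq_frameHessRaw_of_zero` — at a zero of `F₀` the raw frame
  Hessian is symmetric (✓`frameD_frameD_symm_of_zero`), non-negative (✓`hessian_nonneg_at_zero`) and equal to the symmetrised one;
* ★★ `frameHessRaw_mulVec_eq_zero_of_flat` ∕ `frameHess_mulVec_eq_zero_of_flat` — for ANY skew-Hermitian traceless frame family `τ` and any
  coordinate vector `κ`: if `F₀ ≡ 0` along the curve of `Y_κ = dirOf τ κ` through `p`, then `Ĥ(p)κ = 0` and `H(p)κ = 0`;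
* `multiCurve_congr` — `multiCurve` depends only on the assignment (to transport flatness along `dirOf τ κ = Y`).

The companion ✓∕⧗`VirialFluxGapSheetKernel` applies this to the four SHEET directions at a flat comb ring.  HONEST FRAMING: calculus∕linear
algebra plumbing; ⟨24141⟩ and ⟨22884⟩ stay OPEN; no stub ∕ crux ∕ rung ∕ summit is closed; the Yang–Mills mass gap is NOT proved; no summit
is proved by a line.  No definitions, 0 `sorry`, standard axioms.  Width seat `ym-line-sfw-p2-w2` g51 (cell ym-idea-1, free hands),
`--supports stmt-QuantumFields-24141`.  References: [folklore].
-/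

set_option autoImplicit false

noncomputable section

open scoped Matrix BigOperators ContDiff Topology Quaternion
open MeasureTheory Set Matrix
open Literature.MathematicalPhysics.QuantumFieldTheory hiding SU2
open Literature.MathematicalPhysics.QuantumLattice
open Literature.MathematicalPhysics.QuantumFieldTheory.SUNBakryEmery (expSU coe_expSU matTop)

namespace Summit.QuantumFields.YangMills.Theorems.VirialFluxGap.RegularValley

open Summit.QuantumFields.YangMills.Theorems.FemtoTransferGap
open Summit.QuantumFields.YangMills.Theorems.FemtoTransferGap.TT
open Summit.QuantumFields.YangMills.Theorems.FemtoTransferGap.TwoLattice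
open Summit.QuantumFields.YangMills.Theorems.FemtoTransferGap.TwoLattice.Flat
open Summit.QuantumFields.YangMills.Theorems.VirialFluxGap.RingDeficit
open Summit.QuantumFields.YangMills.Theorems.VirialFluxGap.FrameDerivative
open Summit.QuantumFields.YangMills.Theorems.VirialFluxGap.FrameHessian

variable {L : ℕ} [NeZero L]
variable {ι : Type*}

/-- ★ If the deficit vanishes identically along the multi-direction curve `s ↦ p·exp(sY)`, then the second frame derivative
`∂_Y∂_Y F₀` vanishes at `p`. [folklore] -/
theorem frameD_frameD_ringPoly_eq_zero_of_flat (Y : ((Fin (2 * L - 1 + 1) × Edge 3 L) ⊕ Site 3 L) → Matrix (Fin 2) (Fin 2) ℂ)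
    (hY : ∀ w, (Y w)ᴴ = -Y w) (hY0 : ∀ w, (Y w).trace = 0) {p : ((Fin (2 * L - 1 + 1) → GaugeConfig 3 L SU2) × (Site 3 L → SU2))}
    (hflat : ∀ s, ringDeficit L (fun _ => false) (p * multiCurve Y hY hY0 s) = 0) :
    frameD Y (frameD Y (ringPoly L)) (ringCoord L p) = 0 := by
  -- the first derivative along the curve vanishes identically
  have h1 : ∀ s, frameD Y (ringPoly L) (ringCoord L (p * multiCurve Y hY hY0 s)) = 0 := by
    intro s
    have hd := hasDerivAt_ringDeficit_multiCurve Y hY hY0 p s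
    have hc : HasDerivAt (fun s => ringDeficit L (fun _ => false) (p * multiCurve Y hY hY0 s)) 0 s := by
      have heq : (fun s => ringDeficit L (fun _ => false) (p * multiCurve Y hY hY0 s)) = fun _ => (0 : ℝ) := funext hflat
      rw [heq]
      exact hasDerivAt_const s 0
    exact hd.unique hc
  -- hence so does its derivative at `0`
  have h2 : HasDerivAt (fun s => frameD Y (ringPoly L) (ringCoord L (p * multiCurve Y hY hY0 s)))
      (frameD Y (frameD Y (ringPoly L)) (ringCoord L (p * multiCurve Y hY hY0 0))) 0 :=
    hasDerivAt_comp_multiCurve (contDiff_frameD (contDiff_ringPoly (L := L)) Y) Y hY hY0 p 0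
  rw [multiCurve_zero, mul_one] at h2
  have hc : HasDerivAt (fun s => frameD Y (ringPoly L) (ringCoord L (p * multiCurve Y hY hY0 s))) 0 0 := by
    have heq : (fun s => frameD Y (ringPoly L) (ringCoord L (p * multiCurve Y hY hY0 s))) = fun _ => (0 : ℝ) := funext h1
    rw [heq]
    exact hasDerivAt_const 0 0
  exact h2.unique hc

omit [NeZero L] in
/-- ★ A symmetric real matrix with non-negative quadratic form kills its isotropic vectors: `Bᵀ = B`, `vᵀBv ≥ 0` for all `v`, and
`kᵀBk = 0` imply `Bk = 0`. [folklore] -/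
theorem mulVec_eq_zero_of_nonneg_of_isotropic [Fintype ι] {B : Matrix ι ι ℝ} (hsymm : Bᵀ = B) (hnn : ∀ v, 0 ≤ v ⬝ᵥ (B *ᵥ v))
    {k : ι → ℝ} (hk : k ⬝ᵥ (B *ᵥ k) = 0) : B *ᵥ k = 0 := by
  obtain ⟨w, hw⟩ : ∃ w, B *ᵥ k = w := ⟨_, rfl⟩
  have hk' : k ⬝ᵥ w = 0 := by rw [← hw]; exact hk
  have hkw : k ⬝ᵥ (B *ᵥ w) = w ⬝ᵥ w := by rw [ResolventField.dotProduct_mulVec_symm hsymm k w, hw]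
  obtain ⟨a, ha⟩ : ∃ a, w ⬝ᵥ (B *ᵥ w) = a := ⟨_, rfl⟩
  obtain ⟨b, hb⟩ : ∃ b, w ⬝ᵥ w = b := ⟨_, rfl⟩
  have ha0 : 0 ≤ a := by rw [← ha]; exact hnn w
  -- the quadratic form along `k + t w`
  have hq : ∀ t : ℝ, 0 ≤ 2 * t * b + t ^ 2 * a := by
    intro t
    have h := hnn (k + t • w)
    simp only [Matrix.mulVec_add, Matrix.mulVec_smul, add_dotProduct, dotProduct_add, smul_dotProduct, dotProduct_smul, smul_eq_mul,
      hw, hk', hkw, ha, hb] at h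
    nlinarith [h]
  have hbz : b = 0 := by
    have ha1 : 0 < a + 1 := by linarith
    have h := hq (-b / (a + 1))
    have e : 2 * (-b / (a + 1)) * b + (-b / (a + 1)) ^ 2 * a = -(b ^ 2 * (a + 2)) / (a + 1) ^ 2 := by
      field_simp
      ring
    rw [e] at h
    have h2 : b ^ 2 * (a + 2) ≤ 0 := by
      have h3 := mul_nonneg h (le_of_lt (pow_pos ha1 2))
      rw [div_mul_cancel₀ _ (ne_of_gt (pow_pos ha1 2))] at h3
      linarith
    nlinarith [sq_nonneg b]
  -- `w ⬝ w = 0` forces `w = 0`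
  rw [hbz] at hb
  rw [hw]
  funext i
  have hle : w i * w i ≤ 0 := by
    have h := Finset.single_le_sum (f := fun j => w j * w j) (fun j _ => mul_self_nonneg (w j)) (Finset.mem_univ i)
    rw [dotProduct] at hb
    rw [hb] at h
    exact h
  have hwi : w i = 0 := by nlinarith [mul_self_nonneg (w i)]
  rw [Pi.zero_apply]
  exact hwi

/-- At a zero of `F₀` the raw frame Hessian is symmetric. [folklore] -/
theorem frameHessRaw_transpose_of_zero (τ : ι → ((Fin (2 * L - 1 + 1) × Edge 3 L) ⊕ Site 3 L) → Matrix (Fin 2) (Fin 2) ℂ)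
    (hτ : ∀ j w, (τ j w)ᴴ = -τ j w) {p : ((Fin (2 * L - 1 + 1) → GaugeConfig 3 L SU2) × (Site 3 L → SU2))}
    (hp : ringDeficit L (fun _ => false) p = 0) :
    (frameHessRaw (L := L) τ (ringCoord L p))ᵀ = frameHessRaw (L := L) τ (ringCoord L p) := by
  ext j k
  rw [transpose_apply, frameHessRaw, frameHessRaw]
  exact frameD_frameD_symm_of_zero (hτ k) (hτ j) hp

/-- At a zero of `F₀` the raw frame Hessian has non-negative quadratic form. [folklore] -/
theorem frameHessRaw_nonneg_of_zero [Fintype ι] (τ : ι → ((Fin (2 * L - 1 + 1) × Edge 3 L) ⊕ Site 3 L) → Matrix (Fin 2) (Fin 2) ℂ)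
    (hτ : ∀ j w, (τ j w)ᴴ = -τ j w) (hτ0 : ∀ j w, (τ j w).trace = 0)
    {p : ((Fin (2 * L - 1 + 1) → GaugeConfig 3 L SU2) × (Site 3 L → SU2))} (hp : ringDeficit L (fun _ => false) p = 0) (v : ι → ℝ) :
    0 ≤ v ⬝ᵥ (frameHessRaw (L := L) τ (ringCoord L p) *ᵥ v) := by
  rw [← frameD_dirOf_frameD_dirOf]
  exact hessian_nonneg_at_zero (dirOf τ v) (dirOf_conjTranspose hτ v) (dirOf_trace hτ0 v) hp

/-- At a zero of `F₀` the symmetrised frame Hessian IS the raw one. [folklore] -/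
theorem frameHess_eq_frameHessRaw_of_zero (τ : ι → ((Fin (2 * L - 1 + 1) × Edge 3 L) ⊕ Site 3 L) → Matrix (Fin 2) (Fin 2) ℂ)
    (hτ : ∀ j w, (τ j w)ᴴ = -τ j w) {p : ((Fin (2 * L - 1 + 1) → GaugeConfig 3 L SU2) × (Site 3 L → SU2))}
    (hp : ringDeficit L (fun _ => false) p = 0) :
    frameHess (L := L) τ (ringCoord L p) = frameHessRaw (L := L) τ (ringCoord L p) := by
  ext j k
  rw [frameHess]
  have h : frameHessRaw (L := L) τ (ringCoord L p) k j = frameHessRaw (L := L) τ (ringCoord L p) j k := by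
    rw [frameHessRaw, frameHessRaw]
    exact frameD_frameD_symm_of_zero (hτ k) (hτ j) hp
  rw [h]
  ring

/-- ★★ **Flat curve directions are exact kernel vectors.**  For ANY skew-Hermitian traceless frame family `τ` and any coordinate vector
`κ`: if the deficit vanishes identically along the multi-direction curve of `Y_κ = dirOf τ κ` through `p`, then `Ĥ(p)κ = 0`. [folklore] -/
theorem frameHessRaw_mulVec_eq_zero_of_flat [Fintype ι] (τ : ι → ((Fin (2 * L - 1 + 1) × Edge 3 L) ⊕ Site 3 L) → Matrix (Fin 2) (Fin 2) ℂ)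
    (hτ : ∀ j w, (τ j w)ᴴ = -τ j w) (hτ0 : ∀ j w, (τ j w).trace = 0)
    {p : ((Fin (2 * L - 1 + 1) → GaugeConfig 3 L SU2) × (Site 3 L → SU2))} (κ : ι → ℝ)
    (hflat : ∀ s, ringDeficit L (fun _ => false) (p * multiCurve (dirOf τ κ) (dirOf_conjTranspose hτ κ) (dirOf_trace hτ0 κ) s) = 0) :
    frameHessRaw (L := L) τ (ringCoord L p) *ᵥ κ = 0 := by
  have hp : ringDeficit L (fun _ => false) p = 0 := by
    have h := hflat 0
    rwa [multiCurve_zero, mul_one] at h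
  refine mulVec_eq_zero_of_nonneg_of_isotropic (frameHessRaw_transpose_of_zero τ hτ hp) (frameHessRaw_nonneg_of_zero τ hτ hτ0 hp) ?_
  rw [← frameD_dirOf_frameD_dirOf]
  exact frameD_frameD_ringPoly_eq_zero_of_flat _ _ _ hflat

/-- The same for the symmetrised Hessian: `H(p)κ = 0`. [folklore] -/
theorem frameHess_mulVec_eq_zero_of_flat [Fintype ι] (τ : ι → ((Fin (2 * L - 1 + 1) × Edge 3 L) ⊕ Site 3 L) → Matrix (Fin 2) (Fin 2) ℂ)
    (hτ : ∀ j w, (τ j w)ᴴ = -τ j w) (hτ0 : ∀ j w, (τ j w).trace = 0)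
    {p : ((Fin (2 * L - 1 + 1) → GaugeConfig 3 L SU2) × (Site 3 L → SU2))} (κ : ι → ℝ)
    (hflat : ∀ s, ringDeficit L (fun _ => false) (p * multiCurve (dirOf τ κ) (dirOf_conjTranspose hτ κ) (dirOf_trace hτ0 κ) s) = 0) :
    frameHess (L := L) τ (ringCoord L p) *ᵥ κ = 0 := by
  have hp : ringDeficit L (fun _ => false) p = 0 := by
    have h := hflat 0
    rwa [multiCurve_zero, mul_one] at h
  rw [frameHess_eq_frameHessRaw_of_zero τ hτ hp]
  exact frameHessRaw_mulVec_eq_zero_of_flat τ hτ hτ0 κ hflat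

omit [NeZero L] in
/-- `multiCurve` depends only on the direction assignment (proof-irrelevant arguments). [folklore] -/
theorem multiCurve_congr {Y Y' : ((Fin (2 * L - 1 + 1) × Edge 3 L) ⊕ Site 3 L) → Matrix (Fin 2) (Fin 2) ℂ}
    (hY : ∀ w, (Y w)ᴴ = -Y w) (hY0 : ∀ w, (Y w).trace = 0) (hY' : ∀ w, (Y' w)ᴴ = -Y' w) (hY0' : ∀ w, (Y' w).trace = 0) (h : Y = Y') (s : ℝ) :
    multiCurve Y hY hY0 s = multiCurve Y' hY' hY0' s := by
  subst h
  rfl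

end Summit.QuantumFields.YangMills.Theorems.VirialFluxGap.RegularValley

end
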